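import Summits.MatrixMultiplication.OmegaCensus.STPPVosperSlackOneLaw
import Summits.MatrixMultiplication.OmegaCensus.STPP222SqSymmetry
import Summits.MatrixMultiplication.OmegaCensus.STPPDisjointPacking

/-!
# ω-census (abelian STPP census): three SLACK-1 kills at `ℤ₆₁` modulo Hamidoune–Rødseth — including the two doubly-open leaves of NR257 (kernel)

HONEST FRAMING (pub-omega census; verbatim): lottery ticket; floor = certified bounds/negative ranges.
Census STRUCTURE (seat pub-omega-stpp-1 gen 30, 2026-08-28), family (b2).  Applications of the slack-1 Vosper law `no_isSTPP_of_slack_one_tables_prime`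
(`STPPVosperSlackOneLaw.lean`).  EVERY THEOREM OF THIS FILE IS CONDITIONAL on `HamidouneRodsethInverseTheorem` (Hamidoune–Rødseth 2000, stated as
printed in `STPPVosperSlackOneSteps.lean`, not proved in the tree): the census must read these leaves as "kernel-dead MODULO a published inverse
theorem", not as kernel-dead.  Nothing here is progress on `ω`.

The three patterns are minimal beating patterns of `ℤ₆₁` (`Σ aᵢbᵢcᵢ = 62`) alive under the python filters of record N7–N20 and OUT OF REACH of the
N18-tight laws (their best N18 readings have slack one; HOME `pub-omega-stpp-1-g29/scan/KERNEL-KILLS-Z61.json`).  The first two are the leaves OPEN ON BOTH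
AXES (engine and kernel) of the joined `ℤ₆₁` front of record (OMEGA-TABLE NR257, 2026-08-28): `{(2,2,2),(2,3,3),(2,3,3),(3,2,3)}` and
`{(2,2,2),(2,3,3),(3,2,3),(3,3,2)}`.

| pattern | reading | slack-1 block | `(z, b, vol, a, L)` | `(n, m, b)` | tables |
|---|---|---|---|---|---|
| `{(2,2,2),(2,3,3),(2,3,3),(3,2,3)}` | `(c,a,b)` = `(C,A,B)` (`stpp_rotate` twice) | `(3,3,2)` | `(22,3,18,3,16)` | `(36,18,3)` | γ `(36,18,3)`, α `(37,20,3)`, β `(37,18,3)` |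
| `{(2,2,2),(2,3,3),(3,2,3),(3,3,2)}` | `(a,b,c)` | `(3,3,2)` | `(19,3,18,3,19)` | `(39,21,3)` | γ `(39,21,3)`, α `(40,23,3)`, β `(40,21,3)` |
| `{(2,2,5),(2,4,3),(3,3,2)}` | `(b,a,c)` = `(−B,−A,−C)` | `(3,3,2)` | `(22,3,18,3,16)` | `(36,18,3)` | as row 1 |

Independent python reading of the six tables (exact mirror of the `Bool` checkers): HOME `pub-omega-stpp-1-g30/code/lean_tables.py` (all `True`); the
slack bookkeeping per reading: `code/chains.py`; the survivor scan that found these readings: `code/slack1_scan.py`.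

References: Y. O. Hamidoune, Ø. J. Rødseth, Acta Arith. 92 (2000) 251–262; O. Serra, G. Zémor, Integers 0 (2000) A10, Thm 3; A. G. Vosper, J. London
Math. Soc. 31 (1956); M. B. Nathanson, GTM 165, Thm 2.7; H. Cohn, R. Kleinberg, B. Szegedy, C. Umans, FOCS 2005 (arXiv:math/0511460), Def. 5.1.
-/

open Finset
open scoped Pointwise

namespace Summit.MatrixMultiplication.OmegaCensus.CubeNB

open Literature.Computability.AlgebraicComplexity
open Literature.Combinatorics.Additive
open Summit.MatrixMultiplication.OmegaCensus.STPPKneser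

/-! ## The six tables (`decide +kernel`) -/

section Tables

/-- Tight-type table `(n, m, r) = (36, 18, 3)` at `61`: the 18 positions `(t + j·i) mod 61` in `[0,36)` with the prefix law `3 ∣ pos − #(earlier below)` force
`j ∈ {0, 1, 60}`. [folklore] -/
theorem table_36_18_3 : ∀ j < 61, ∀ t < 61, (∀ i < 18, (t + j * i) % 61 < 36) →
    (∀ k < 18, 3 ∣ (t + j * k) % 61 - #((range 18).filter fun i => (t + j * i) % 61 < (t + j * k) % 61)) →
    j ∈ ({0, 1, 60} : Finset ℕ) := by
  decide +kernel

/-- Case-α table `(n, m, r) = (37, 20, 3)` at `61` (almost-progression of 19 of 20 terms in `[0,37)`, complement tiled by 3-runs ⇒ `j ∈ {0, 1, 60}`). [folklore] -/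
theorem tableAlpha_61_37_20_3 : tableAlpha 61 37 20 3 {0, 1, 60} = true := by
  decide +kernel

/-- Case-β table `(n₁, m, b) = (37, 18, 3)` at `61` (window `[0,37)` with one hole, an 18-term progression removed, the rest never greedily tiled by
translates of `{0,1,2,3} ∖ {g₀+1}` unless `j ∈ {0, 1, 60}`). [folklore] -/
theorem tableBeta_61_37_18_3 : tableBeta 61 37 18 3 {0, 1, 60} = true := by
  decide +kernel

/-- Tight-type table `(n, m, r) = (39, 21, 3)` at `61`. [folklore] -/
theorem table_39_21_3 : ∀ j < 61, ∀ t < 61, (∀ i < 21, (t + j * i) % 61 < 39) →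
    (∀ k < 21, 3 ∣ (t + j * k) % 61 - #((range 21).filter fun i => (t + j * i) % 61 < (t + j * k) % 61)) →
    j ∈ ({0, 1, 60} : Finset ℕ) := by
  decide +kernel

/-- Case-α table `(n, m, r) = (40, 23, 3)` at `61`. [folklore] -/
theorem tableAlpha_61_40_23_3 : tableAlpha 61 40 23 3 {0, 1, 60} = true := by
  decide +kernel

/-- Case-β table `(n₁, m, b) = (40, 21, 3)` at `61`. [folklore] -/
theorem tableBeta_61_40_21_3 : tableBeta 61 40 21 3 {0, 1, 60} = true := by
  decide +kernel

end Tables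

/-! ## The three conditional kills -/

section Kills

/-- **`{(2,2,2),(2,3,3),(3,2,3),(3,3,2)}` has no STPP family in `ℤ₆₁`, PROVIDED the Hamidoune–Rødseth inverse theorem** — one of the two leaves of the
joined `ℤ₆₁` front open on both axes (NR257).  Slack-1 law in the reading `(a,b,c)` at the block `(3,3,2)`: `(z, b, vol, a, L) = (19, 3, 18, 3, 19)`, tables
`(39,21,3)`, α `(40,23,3)`, β `(40,21,3)`. [cite: CohnKleinbergSzegedyUmans2005, Def. 5.1] [cite: HamidouneRodseth2000, main theorem (§1, p. 252)]
[cite: Nathanson1996, Thm 2.7] -/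
theorem no_isSTPP_zmod61_222_233_323_332_of_hamidouneRodseth (hHR : HamidouneRodsethInverseTheorem)
    (A B C : Fin 4 → Finset (ZMod 61)) (hS : IsSTPP A B C)
    (hA : ∀ i, #(A i) = ![2, 2, 3, 3] i) (hB : ∀ i, #(B i) = ![2, 3, 2, 3] i) (hC : ∀ i, #(C i) = ![2, 3, 3, 2] i) :
    False := by
  haveI : Fact (Nat.Prime 61) := ⟨prime_61⟩
  have hAne : ∀ i, (A i).Nonempty := fun i => card_pos.1 (by rw [hA]; fin_cases i <;> simp)
  have hBne : ∀ i, (B i).Nonempty := fun i => card_pos.1 (by rw [hB]; fin_cases i <;> simp)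
  have hCne : ∀ i, (C i).Nonempty := fun i => card_pos.1 (by rw [hC]; fin_cases i <;> simp)
  have e3 : (univ : Finset (Fin 4)).erase 3 = {0, 1, 2} := by decide
  have hz : ∑ k ∈ (univ : Finset (Fin 4)).erase 3, #(A k) * #(C k) = 19 := by
    rw [e3]; simp [Finset.sum_insert, hA, hC]
  have hL : ∑ k ∈ (univ : Finset (Fin 4)).erase 3, #(B k) * #(C k) = 19 := by
    rw [e3]; simp [Finset.sum_insert, hB, hC]
  have ha : #(A 3) = 3 := by rw [hA]; simp
  have hb : #(B 3) = 3 := by rw [hB]; simp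
  have hvol : #(A 3) * #(B 3) * #(C 3) = 18 := by rw [hA, hB, hC]; simp
  exact no_isSTPP_of_slack_one_tables_prime hHR A B C hS hAne hBne hCne 3 ⟨0, by decide⟩ ha hb hvol hz hL (by norm_num) (by norm_num)
    (by norm_num) (by norm_num) (by norm_num) (m := 21) (n := 39) rfl rfl table_39_21_3 tableAlpha_61_40_23_3 tableBeta_61_40_21_3

/-- **`{(2,2,2),(2,3,3),(2,3,3),(3,2,3)}` has no STPP family in `ℤ₆₁`, PROVIDED the Hamidoune–Rødseth inverse theorem** — the other leaf of the joined
`ℤ₆₁` front open on both axes (NR257).  Slack-1 law in the reading `(c,a,b)`, i.e. for the STPP family `(C, A, B)` (`stpp_rotate` twice), at the block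
`(3,2,3) ↦ (3,3,2)`: `(z, b, vol, a, L) = (22, 3, 18, 3, 16)`, tables `(36,18,3)`, α `(37,20,3)`, β `(37,18,3)`.
[cite: CohnKleinbergSzegedyUmans2005, Def. 5.1] [cite: HamidouneRodseth2000, main theorem (§1, p. 252)] [cite: Nathanson1996, Thm 2.7] -/
theorem no_isSTPP_zmod61_222_233_233_323_of_hamidouneRodseth (hHR : HamidouneRodsethInverseTheorem)
    (A B C : Fin 4 → Finset (ZMod 61)) (hS : IsSTPP A B C)
    (hA : ∀ i, #(A i) = ![2, 2, 2, 3] i) (hB : ∀ i, #(B i) = ![2, 3, 3, 2] i) (hC : ∀ i, #(C i) = ![2, 3, 3, 3] i) :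
    False := by
  haveI : Fact (Nat.Prime 61) := ⟨prime_61⟩
  have hS' : IsSTPP C A B := stpp_rotate (stpp_rotate hS)
  have hAne : ∀ i, (A i).Nonempty := fun i => card_pos.1 (by rw [hA]; fin_cases i <;> simp)
  have hBne : ∀ i, (B i).Nonempty := fun i => card_pos.1 (by rw [hB]; fin_cases i <;> simp)
  have hCne : ∀ i, (C i).Nonempty := fun i => card_pos.1 (by rw [hC]; fin_cases i <;> simp)
  have e3 : (univ : Finset (Fin 4)).erase 3 = {0, 1, 2} := by decide
  have hz : ∑ k ∈ (univ : Finset (Fin 4)).erase 3, #(C k) * #(B k) = 22 := by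
    rw [e3]; simp [Finset.sum_insert, hB, hC]
  have hL : ∑ k ∈ (univ : Finset (Fin 4)).erase 3, #(A k) * #(B k) = 16 := by
    rw [e3]; simp [Finset.sum_insert, hA, hB]
  have ha : #(C 3) = 3 := by rw [hC]; simp
  have hb : #(A 3) = 3 := by rw [hA]; simp
  have hvol : #(C 3) * #(A 3) * #(B 3) = 18 := by rw [hA, hB, hC]; simp
  exact no_isSTPP_of_slack_one_tables_prime hHR C A B hS' hCne hAne hBne 3 ⟨0, by decide⟩ ha hb hvol hz hL (by norm_num) (by norm_num)
    (by norm_num) (by norm_num) (by norm_num) (m := 18) (n := 36) rfl rfl table_36_18_3 tableAlpha_61_37_20_3 tableBeta_61_37_18_3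

/-- **`{(2,2,5),(2,4,3),(3,3,2)}` has no STPP family in `ℤ₆₁`, PROVIDED the Hamidoune–Rødseth inverse theorem** (a kernel-open leaf of the `ℤ₆₁` front;
ENGINE-dead through the pair cores of record).  Slack-1 law in the reading `(b,a,c)`, i.e. for the STPP family `(−B, −A, −C)` (`stpp_rotate`, then
`isSTPP_negSwap`), at the block `(3,3,2)`: `(z, b, vol, a, L) = (22, 3, 18, 3, 16)`, tables as for the previous theorem.
[cite: CohnKleinbergSzegedyUmans2005, Def. 5.1] [cite: HamidouneRodseth2000, main theorem (§1, p. 252)] [cite: Nathanson1996, Thm 2.7] -/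
theorem no_isSTPP_zmod61_225_243_332_of_hamidouneRodseth (hHR : HamidouneRodsethInverseTheorem)
    (A B C : Fin 3 → Finset (ZMod 61)) (hS : IsSTPP A B C)
    (hA : ∀ i, #(A i) = ![2, 2, 3] i) (hB : ∀ i, #(B i) = ![2, 4, 3] i) (hC : ∀ i, #(C i) = ![5, 3, 2] i) :
    False := by
  haveI : Fact (Nat.Prime 61) := ⟨prime_61⟩
  have hAne : ∀ i, (A i).Nonempty := fun i => card_pos.1 (by rw [hA]; fin_cases i <;> simp)
  have hBne : ∀ i, (B i).Nonempty := fun i => card_pos.1 (by rw [hB]; fin_cases i <;> simp)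
  have hCne : ∀ i, (C i).Nonempty := fun i => card_pos.1 (by rw [hC]; fin_cases i <;> simp)
  -- the family (−B, −A, −C)
  set A' : Fin 3 → Finset (ZMod 61) := fun t => (B t).image Neg.neg with hA'
  set B' : Fin 3 → Finset (ZMod 61) := fun t => (A t).image Neg.neg with hB'
  set C' : Fin 3 → Finset (ZMod 61) := fun t => (C t).image Neg.neg with hC'
  have hS' : IsSTPP A' B' C' := STPP222SqNeg.isSTPP_negSwap (stpp_rotate hS)
  have hcA' : ∀ t, #(A' t) = #(B t) := fun t => Finset.card_image_of_injective _ neg_injective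
  have hcB' : ∀ t, #(B' t) = #(A t) := fun t => Finset.card_image_of_injective _ neg_injective
  have hcC' : ∀ t, #(C' t) = #(C t) := fun t => Finset.card_image_of_injective _ neg_injective
  have hAne' : ∀ t, (A' t).Nonempty := fun t => (hBne t).image _
  have hBne' : ∀ t, (B' t).Nonempty := fun t => (hAne t).image _
  have hCne' : ∀ t, (C' t).Nonempty := fun t => (hCne t).image _
  have e2 : (univ : Finset (Fin 3)).erase 2 = {0, 1} := by decide
  have hz : ∑ k ∈ (univ : Finset (Fin 3)).erase 2, #(A' k) * #(C' k) = 22 := by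
    rw [e2, Finset.sum_pair (by decide)]; simp [hcA', hcC', hB, hC]
  have hL : ∑ k ∈ (univ : Finset (Fin 3)).erase 2, #(B' k) * #(C' k) = 16 := by
    rw [e2, Finset.sum_pair (by decide)]; simp [hcB', hcC', hA, hC]
  have ha : #(A' 2) = 3 := by rw [hcA', hB]; simp
  have hb : #(B' 2) = 3 := by rw [hcB', hA]; simp
  have hvol : #(A' 2) * #(B' 2) * #(C' 2) = 18 := by rw [hcA', hcB', hcC', hA, hB, hC]; simp
  exact no_isSTPP_of_slack_one_tables_prime hHR A' B' C' hS' hAne' hBne' hCne' 2 ⟨0, by decide⟩ ha hb hvol hz hL (by norm_num) (by norm_num)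
    (by norm_num) (by norm_num) (by norm_num) (m := 18) (n := 36) rfl rfl table_36_18_3 tableAlpha_61_37_20_3 tableBeta_61_37_18_3

end Kills

end Summit.MatrixMultiplication.OmegaCensus.CubeNB
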